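/-
Origin: expansion seat `planner-pub-hodgecm-pv09-g4-0`, handover #10 2026-08-18T08:02:43Z (`HOME/pub-hodgecm-pv09-g4/lean/Pv09g4/RestrictedRegroup.lean`, md5 6feb7175, 222 lines);
landed by the gen-7 packager in gate run 26 as `HodgeCM/PerL34/RestrictedRegroup.lean` (verbatim).
-/
/-
HodgeCM / PerL34 publication cell — seam S3 set-up, model side (pub-hodgecm-pv09-g4, HANDOVER #10).
Mathlib-only imports.  Complete proofs, no new axioms, nothing cited.
-/
import Mathlib.Topology.Algebra.RestrictedProduct.TopologicalSpace
import Mathlib.Topology.Algebra.ContinuousMonoidHom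
import Mathlib.Algebra.Group.Subgroup.Basic

/-!
# Regrouping a restricted product along a finite-to-one map of index sets

For topological groups `G i` (`i : ι`) with open subgroups `B i` and a map of index sets `f : ι → κ`
with finite fibres (`Tendsto f cofinite cofinite`), the restricted product over `ι` IS the restricted
product over `κ` of the finite products over the fibres:

  `Πʳ i, [G i, B i] ≃ₜ* Πʳ k, [Π i : f⁻¹ k, G i, Π i : f⁻¹ k, B i]`     (`regroupEquiv`).

(The use in seam S3: the ideles `Πʳ_w [L_wˣ, 𝒪_wˣ]` over the places `w` of `L`, regrouped over the places
`v` of `K ⊆ L` along `w ↦ w ∩ K`, become `Πʳ_v [Π_{w ∣ v} L_wˣ, Π_{w ∣ v} 𝒪_wˣ] = Πʳ_v [(L ⊗_K K_v)ˣ, …]`,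
inside which the local unitary groups `U(1)(K_v)` are cut out fibrewise — GAPS pv09g4-A5.)

* `Fib f k = {i // f i = k}`; `fibSubgroup B f k = Π_{i ∈ Fib f k} B i ≤ Π_{i ∈ Fib f k} G i`;
* `regroup` / `unregroup` — the two maps, mutually inverse, multiplicative, continuous
  (Mathlib's universal property `RestrictedProduct.continuous_dom` + `continuous_rng_of_principal` on the
  principal pieces, as in Mathlib's `RestrictedProduct.mapAlong_continuous`);
* `regroupEquiv : Πʳ i, [G i, B i] ≃ₜ* Πʳ k, [Π i : Fib f k, G i, fibSubgroup B f k]`;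
* `isOpen_fibSubgroup` and the `Fact` instance making the right-hand side a topological group.
-/

set_option autoImplicit false

noncomputable section

open Topology Filter Set
open scoped RestrictedProduct

namespace HodgeCM.PerL34.RestrictedRegroup

variable {ι κ : Type*} {G : ι → Type*} [∀ i, Group (G i)] (B : ∀ i, Subgroup (G i)) (f : ι → κ)

/-- The fibre of `f` over `k`. -/
abbrev Fib (k : κ) : Type _ := {i : ι // f i = k}

/-- `Π_{i ∈ f⁻¹ k} B i` as a subgroup of `Π_{i ∈ f⁻¹ k} G i`. -/
abbrev fibSubgroup (k : κ) : Subgroup (Π i : Fib f k, G i.1) :=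
  Subgroup.pi Set.univ fun i : Fib f k => B i.1

/-- (Ported verbatim from the HodgeCMPerL package; no docstring in the source.) -/
theorem mem_fibSubgroup_iff {k : κ} (x : Π i : Fib f k, G i.1) :
    x ∈ fibSubgroup B f k ↔ ∀ i : Fib f k, x i ∈ B i.1 := by
  simp [Subgroup.mem_pi]

/-! ## The two maps -/

/-- `(x_i)_i ↦ ((x_i)_{i ∈ f⁻¹ k})_k`. -/
def regroup (x : Πʳ i, [G i, B i]) : Πʳ k, [Π i : Fib f k, G i.1, fibSubgroup B f k] :=
  ⟨fun k i => x i.1, by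
    have hfin : Set.Finite {i : ι | x i ∉ (B i : Set (G i))} := by
      have h := x.2
      rw [eventually_cofinite] at h
      exact h
    refine (eventually_cofinite.mpr ((hfin.image f).subset ?_))
    intro k hk
    simp only [mem_setOf_eq, SetLike.mem_coe, mem_fibSubgroup_iff, not_forall] at hk
    obtain ⟨i, hi⟩ := hk
    exact ⟨i.1, hi, i.2⟩⟩

/-- (Ported verbatim from the HodgeCMPerL package; no docstring in the source.) -/
@[simp] theorem regroup_apply (x : Πʳ i, [G i, B i]) (k : κ) (i : Fib f k) :
    regroup B f x k i = x i.1 := rfl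

variable {f} in
/-- `((y_{k,i})_{i ∈ f⁻¹ k})_k ↦ (y_{f i, i})_i` (finite fibres needed for the restricted-product condition). -/
def unregroup (hf : Tendsto f cofinite cofinite) (y : Πʳ k, [Π i : Fib f k, G i.1, fibSubgroup B f k]) :
    Πʳ i, [G i, B i] :=
  ⟨fun i => y (f i) ⟨i, rfl⟩, by
    have hy : ∀ᶠ k in cofinite, y k ∈ (fibSubgroup B f k : Set (Π i : Fib f k, G i.1)) := y.2
    filter_upwards [hf.eventually hy] with i hi
    rw [SetLike.mem_coe, mem_fibSubgroup_iff] at hi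
    exact hi ⟨i, rfl⟩⟩

/-- (Ported verbatim from the HodgeCMPerL package; no docstring in the source.) -/
@[simp] theorem unregroup_apply (hf : Tendsto f cofinite cofinite)
    (y : Πʳ k, [Π i : Fib f k, G i.1, fibSubgroup B f k]) (i : ι) :
    unregroup B hf y i = y (f i) ⟨i, rfl⟩ := rfl

/-- (Ported verbatim from the HodgeCMPerL package; no docstring in the source.) -/
theorem unregroup_regroup (hf : Tendsto f cofinite cofinite) (x : Πʳ i, [G i, B i]) :
    unregroup B hf (regroup B f x) = x := by
  ext i; rfl

/-- (Ported verbatim from the HodgeCMPerL package; no docstring in the source.) -/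
theorem regroup_unregroup (hf : Tendsto f cofinite cofinite)
    (y : Πʳ k, [Π i : Fib f k, G i.1, fibSubgroup B f k]) : regroup B f (unregroup B hf y) = y := by
  ext k i
  obtain ⟨i, rfl⟩ := i
  rfl

/-- (Ported verbatim from the HodgeCMPerL package; no docstring in the source.) -/
theorem regroup_mul (x x' : Πʳ i, [G i, B i]) :
    regroup B f (x * x') = regroup B f x * regroup B f x' := by
  ext k; rfl

/-! ## Continuity -/

section topology

variable [∀ i, TopologicalSpace (G i)]

/-- `regroup` is continuous. -/
theorem continuous_regroup : Continuous (regroup B f) := by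
  rw [RestrictedProduct.continuous_dom]
  intro S hS
  have hSc : Sᶜ.Finite := by
    have : S ∈ (cofinite : Filter ι) := le_principal_iff.mp hS
    exact this
  -- the piece over `S` lands in the piece over `T := (f '' Sᶜ)ᶜ`
  set T : Set κ := (f '' Sᶜ)ᶜ with hTdef
  have hT : (cofinite : Filter κ) ≤ 𝓟 T := by
    rw [le_principal_iff, hTdef]
    exact (hSc.image f).compl_mem_cofinite
  let g : Πʳ i, [G i, B i]_[𝓟 S] → Πʳ k, [Π i : Fib f k, G i.1, fibSubgroup B f k]_[𝓟 T] :=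
    fun x => ⟨fun k i => x i.1, by
      have hx : ∀ i ∈ S, x i ∈ (B i : Set (G i)) := by
        have h := (x.2 : ∀ᶠ i in 𝓟 S, x i ∈ (B i : Set (G i)))
        rwa [eventually_principal] at h
      rw [eventually_principal]
      intro k hk
      rw [SetLike.mem_coe, mem_fibSubgroup_iff]
      intro i
      by_contra hni
      apply hk
      exact ⟨i.1, fun hiS => hni (hx i.1 hiS), i.2⟩⟩
  have hg : Continuous g := by
    rw [RestrictedProduct.continuous_rng_of_principal]
    exact continuous_pi fun k => continuous_pi fun i =>
      (continuous_apply i.1).comp RestrictedProduct.continuous_coe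
  have hfac : regroup B f ∘ RestrictedProduct.inclusion _ _ hS =
      RestrictedProduct.inclusion _ _ hT ∘ g := by
    funext x
    rfl
  rw [hfac]
  exact (RestrictedProduct.continuous_inclusion hT).comp hg

/-- `unregroup` is continuous. -/
theorem continuous_unregroup (hf : Tendsto f cofinite cofinite) : Continuous (unregroup B hf) := by
  rw [RestrictedProduct.continuous_dom]
  intro T hT
  -- the piece over `T` lands in the piece over `S := f ⁻¹' T`
  have hS : (cofinite : Filter ι) ≤ 𝓟 (f ⁻¹' T) :=
    le_principal_iff.mpr (hf (le_principal_iff.mp hT))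
  let g : Πʳ k, [Π i : Fib f k, G i.1, fibSubgroup B f k]_[𝓟 T] → Πʳ i, [G i, B i]_[𝓟 (f ⁻¹' T)] :=
    fun y => ⟨fun i => y (f i) ⟨i, rfl⟩, by
      have hy : ∀ k ∈ T, y k ∈ (fibSubgroup B f k : Set (Π i : Fib f k, G i.1)) := by
        have h := (y.2 : ∀ᶠ k in 𝓟 T, y k ∈ (fibSubgroup B f k : Set (Π i : Fib f k, G i.1)))
        rwa [eventually_principal] at h
      rw [eventually_principal]
      intro i hi
      have h := hy (f i) hi
      rw [SetLike.mem_coe, mem_fibSubgroup_iff] at h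
      exact h ⟨i, rfl⟩⟩
  have hg : Continuous g := by
    rw [RestrictedProduct.continuous_rng_of_principal]
    exact continuous_pi fun i =>
      (continuous_apply (⟨i, rfl⟩ : Fib f (f i))).comp
        ((continuous_apply (f i)).comp RestrictedProduct.continuous_coe)
  have hfac : unregroup B hf ∘ RestrictedProduct.inclusion _ _ hT =
      RestrictedProduct.inclusion _ _ hS ∘ g := by
    funext y
    rfl
  rw [hfac]
  exact (RestrictedProduct.continuous_inclusion hS).comp hg

variable {f} in
/-- **Regrouping a restricted product along a finite-to-one map of index sets**, as an isomorphism of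
topological groups. -/
def regroupEquiv (hf : Tendsto f cofinite cofinite) :
    (Πʳ i, [G i, B i]) ≃ₜ* Πʳ k, [Π i : Fib f k, G i.1, fibSubgroup B f k] where
  toFun := regroup B f
  invFun := unregroup B hf
  left_inv := unregroup_regroup B f hf
  right_inv := regroup_unregroup B f hf
  map_mul' := regroup_mul B f
  continuous_toFun := continuous_regroup B f
  continuous_invFun := continuous_unregroup B f hf

/-- (Ported verbatim from the HodgeCMPerL package; no docstring in the source.) -/
@[simp] theorem regroupEquiv_apply (hf : Tendsto f cofinite cofinite) (x : Πʳ i, [G i, B i]) (k : κ)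
    (i : Fib f k) : regroupEquiv B hf x k i = x i.1 := rfl

/-- (Ported verbatim from the HodgeCMPerL package; no docstring in the source.) -/
@[simp] theorem regroupEquiv_symm_apply (hf : Tendsto f cofinite cofinite)
    (y : Πʳ k, [Π i : Fib f k, G i.1, fibSubgroup B f k]) (i : ι) :
    (regroupEquiv B hf).symm y i = y (f i) ⟨i, rfl⟩ := rfl

/-- Finite fibres from `Tendsto f cofinite cofinite`. -/
theorem finite_fib (hf : Tendsto f cofinite cofinite) (k : κ) : Finite (Fib f k) := by
  have h : f ⁻¹' ({k}ᶜ) ∈ (cofinite : Filter ι) := hf (finite_singleton k).compl_mem_cofinite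
  have h' : (f ⁻¹' {k}).Finite := by
    rw [mem_cofinite, preimage_compl, compl_compl] at h
    exact h
  exact (h'.coe_toFinset ▸ h'.toFinset.finite_toSet).to_subtype

/-- The fibre boxes `Π_{i ∈ f⁻¹ k} B i` are open when the `B i` are open and the fibres finite. -/
theorem isOpen_fibSubgroup (hBo : ∀ i, IsOpen (B i : Set (G i))) (hf : Tendsto f cofinite cofinite)
    (k : κ) : IsOpen (fibSubgroup B f k : Set (Π i : Fib f k, G i.1)) := by
  haveI := finite_fib f hf k
  have h : (fibSubgroup B f k : Set (Π i : Fib f k, G i.1)) =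
      Set.pi Set.univ fun i : Fib f k => (B i.1 : Set (G i.1)) := by
    ext x
    simp [mem_fibSubgroup_iff]
  rw [h]
  exact isOpen_set_pi finite_univ fun i _ => hBo i.1

/-- The `Fact` instance making `Πʳ k, [Π i : Fib f k, G i, fibSubgroup B f k]` a topological group
(Mathlib `RestrictedProduct.isTopologicalGroup`), from the corresponding `Fact`s on `B` and `f`. -/
instance fact_isOpen_fibSubgroup [hBo : Fact (∀ i, IsOpen (B i : Set (G i)))]
    [hf : Fact (Tendsto f cofinite cofinite)] :
    Fact (∀ k, IsOpen (fibSubgroup B f k : Set (Π i : Fib f k, G i.1))) :=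
  ⟨isOpen_fibSubgroup B f hBo.out hf.out⟩

example [∀ i, IsTopologicalGroup (G i)] [Fact (∀ i, IsOpen (B i : Set (G i)))]
    [Fact (Tendsto f cofinite cofinite)] :
    IsTopologicalGroup (Πʳ k, [Π i : Fib f k, G i.1, fibSubgroup B f k]) := inferInstance

end topology

end HodgeCM.PerL34.RestrictedRegroup

end
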